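import Summits.QuantumFields.BalabanUV.T4Continuum.Support.B13Carriers
import Literature.MathematicalPhysics.QuantumFieldTheory.Balaban1983to89.T4BetaReadOutLipschitz

/-!
# SUBSTRATE — THE PROBE SKELETON OF RECORD on the carriers of record: node U2's read-out probes (`T4BetaReadOutLipschitz.Probes`)
# indexed by the SINGLE-CUBE localization domains of the next scale, with the locality sum computed EXACTLY (single cubes have
# `d = 0`) and the analyticity face DISPLAYED (item S-PROBE of `substrate/SUBSTRATE-MAP.md`; typer sketch v0.2 §PR)

Cell `pub-balaban`, SUBSTRATE cell, seat `b2b-balaban-substrate-p1` («instances first»; MAP §4: «S-PROBE (p1) ⇒ NE4 L3 `hnorm`»).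
Summits-side under the LEAN PLACEMENT RULE.  HONEST FRAMING: rung (B)+1 of the FINITE-VOLUME T⁴ programme — NOT infinite volume, NOT a
mass gap, NOT Clay; spine PROVED 0∕9.  TYPING + BOOKKEEPING: the probe structure's index∕domain∕scale fields are FIXED here on the
carriers of record (`B13Carriers.TwoRuns.carriers`, p207668); its directions, weights and Re∕Im chart maps stay DATA of the instancer
(recipe of record: `T4CubeChartExp.expFibreChart` points, `NE9ComplexEncoding` tags — MAP §2 S-PROBE); NOTHING of [Balaban1987RG1]
(1.20)–(1.22) p. 264 is asserted (the β-function read-out is row NE4's), and the analyticity of any functional on any chart set is a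
DISPLAYED hypothesis (`ChartAnalytic`; typer Q-S2: it needs `ρ_k ≠ 0` on the chart polydisc — a small-field INPUT, never asserted).
HONEST DEPENDENCY (cell line, verbatim): continuum YM on T⁴ ⇐ BetaPertH ∧ nine spine estimates (0/9 proved); BetaPertH ⇐ (D1) ∧ (D4) ∧
CAP+tail; G-an2-4 gates asym, D1 and NE2/3/4.

WHAT.
* §1 THE SINGLE-CUBE CATALOGUE `cubeIdx R k ⊆ domAt (k + 1)`: the localization domains of scale `k + 1` consisting of ONE cube of
  `π_{k+1}` (the probes of (1.20) read the newest term `E^{(k+1)}` at single sites∕cubes); membership, the canonical members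
  `mkDom (k+1) (singleDom a)`, non-emptiness, and `d = 0` on it (`d_eq_zero_of_mem_cubeIdx`, from `TwoRuns.d_singleDom`).
* §2 **`cubeProbes R dirA dirB wt chartRe chartIm : Probes R.carriers Bg V R.carriers.Dom`** (sketch v0.2 `cubeProbes` with `idx :=
  cubeIdx R`, `dom := id`, `scale_dom` by `mem_domAt`); `transportTo_cubeProbes` (run A's probes = run B's with transported charts,
  `rfl`); `cubeProbes_idx_nonempty` (node U2's binder `hne`).
* §3 THE LOCALITY SUM EXACTLY: `localitySum_cubeProbes_iff` — `Probes.LocalitySum κ K ↔ ∀ k, Σ_{p ∈ cubeIdx R k} |wt k p|·‖dirA k p‖·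
  ‖dirB k p‖ ≤ K` (the decay weight is `e^0 = 1` on single cubes), and the SUPPORTED form `localitySum_cubeProbes_of_support`
  (weights vanishing off a set `s k` whose weighted direction sizes are `≤ K` — e.g. the origin cube, the translation-invariant
  reading of (1.22)'s `Σ_x`).
* §4 `ChartAnalytic Pr E g S` — NE4 L3's `hAan` SHAPE (sketch v0.2), DISPLAYED.
* §5 (v1.1, APPEND) THE NORMALISATION FACE `hnorm` BY CONSTRUCTION: the recipe is LINEAR IN THE WEIGHTS, so rescaling the weights
  step by step (`rescale`) rescales the read-out (`recipe_rescale`), commutes with the transport (`transportTo_rescale`), leaves the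
  chart functions and the analytic class untouched (`cplx_rescale`, `analytic_rescale`), and rescales the locality sum (`localitySum_rescale`);
  the WEIGHTS OF RECORD are the ones normalised on the marginal direction `A` (`normalise PB A`), for which node U2's binder
  `hnorm : ∀ k, PB.transportTo.recipe k A = 1` HOLDS (`recipe_transportTo_normalise`) modulo the displayed NON-DEGENERACY «the
  un-normalised recipe reads `A` non-trivially at every step» (`PB.transportTo.recipe k A ≠ 0` — the statement that the marginal direction
  IS read; an O1 INPUT, never asserted); `cubeProbes` corollaries (`normalise_cubeProbes`, `hnorm_cubeProbes`).
* §6 (v1.2, APPEND; MAP v0.5 §4 p1 (3) «S-PROBE v1.1», NE9 owner g30 caveat l.14299 «`chartRe ∕ chartIm : V → Bg` need `Bg ⊇`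
  complex configurations») **`cubeProbesC R dirA dirB wt : Probes R.carriers (V × Bool) V R.carriers.Dom`** — the probes of record on
  the TAGGED complex-chart background sort of `T4BetaReadOutLipschitz` §5 (`tagged`, `tagSlice`: chart point × Re∕Im tag, charts
  `A ↦ (A, true) ∕ (A, false)`; the tag lives in `Bg` because `Probes.cplx` reads ONE domain with TWO background labels), `= tagged (cubeIdx R) …`
  by `rfl`; faithfulness `cplx_cubeProbesC_tagSlice` (the rebuilt chart function IS the complex term), `recipe_cubeProbesC_tagSlice`,
  `tagSlice_mem_analytic_cubeProbesC_iff` (`Probes.Analytic α` ⇔ `AnalyticOnNhd ℂ` of the term on `ball 0 α` at every single cube —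
  supplied at `V := TowerData P o` for entry-built terms by `SubstrateTransporterSpeciesAnalytic.exists_ball_analyticOnNhd_covAtT`),
  `chartAnalytic_cubeProbesC_iff`, `localitySum_cubeProbesC_iff`.
Imports `Support/B13Carriers` + `T4BetaReadOutLipschitz`; nothing existing is modified; v1 ∕ v1.1 declarations byte-identical.
-/

noncomputable section

open Finset
open scoped BigOperators

namespace Summit.QuantumFields.BalabanUV.T4Continuum.SubstrateProbesOfRecord

open Literature.MathematicalPhysics.QuantumFieldTheory.Balaban1983to89
open Literature.MathematicalPhysics.QuantumFieldTheory.Balaban1983to89.T4OutputRate (Carriers Functional)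
open Literature.MathematicalPhysics.QuantumFieldTheory.Balaban1983to89.T4BetaReadOutLipschitz (Probes)
open Literature.MathematicalPhysics.QuantumFieldTheory.Balaban1983to89.TreeLengthTorus (TPt TDom torusTreeLen torusTreeLen_singleton)
open Summit.QuantumFields.BalabanUV.T4Continuum.B13Carriers (TwoRuns singleDom singleDom_val)

variable {G : Type} [GaugeGroup G] (R : TwoRuns G)

/-! ## §1 The single-cube catalogue of the next scale -/

/-- [folklore] THE SINGLE-CUBE DOMAINS OF SCALE `k + 1`: the probes read at step `k`. -/
def cubeIdx (k : ℕ) : Finset R.carriers.Dom := (R.domAt (k + 1)).filter fun X => X.2.1.card = 1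

variable {R}

/-- [folklore] Membership: scale `k + 1` and exactly one cube. -/
theorem mem_cubeIdx {k : ℕ} {X : R.carriers.Dom} : X ∈ cubeIdx R k ↔ R.carriers.scale X = k + 1 ∧ X.2.1.card = 1 := by
  rw [cubeIdx, mem_filter, TwoRuns.mem_domAt]

/-- [folklore] Members lie on the scale-`(k+1)` slice. -/
theorem scale_of_mem_cubeIdx {k : ℕ} {X : R.carriers.Dom} (h : X ∈ cubeIdx R k) : R.carriers.scale X = k + 1 :=
  (mem_cubeIdx.1 h).1

/-- [folklore] Members have exactly one cube. -/
theorem card_of_mem_cubeIdx {k : ℕ} {X : R.carriers.Dom} (h : X ∈ cubeIdx R k) : X.2.1.card = 1 := (mem_cubeIdx.1 h).2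

variable (R) in
/-- [folklore] The canonical members: the single-cube domain at the cube `a` of `π_{k+1}`. -/
theorem singleDom_mem_cubeIdx (k : ℕ) (a : TPt 4 (R.cubesPerDir (k + 1))) : R.mkDom (k + 1) (singleDom a) ∈ cubeIdx R k :=
  mem_cubeIdx.2 ⟨rfl, by simp [TwoRuns.mkDom, singleDom_val]⟩

variable (R) in
/-- [folklore] Every step has a probe domain (node U2's binder `hne`). -/
theorem cubeIdx_nonempty (k : ℕ) : (cubeIdx R k).Nonempty := ⟨_, singleDom_mem_cubeIdx R k 0⟩

/-- [folklore] **SINGLE CUBES HAVE LINEAR SIZE `d = 0`** (`torusTreeLen_singleton`). -/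
theorem d_eq_zero_of_mem_cubeIdx {k : ℕ} {X : R.carriers.Dom} (h : X ∈ cubeIdx R k) : R.carriers.d X = 0 := by
  obtain ⟨a, ha⟩ := card_eq_one.1 (card_of_mem_cubeIdx h)
  rw [TwoRuns.carriers_d, ha, torusTreeLen_singleton]

/-! ## §2 The probe skeleton of record -/

section Skeleton

variable (R)
variable {Bg : Type} {V : Type*} [NormedAddCommGroup V] [NormedSpace ℂ V]

/-- [folklore] **SINGLE-CUBE PROBES OF RECORD** on the carriers of record: index type = the carriers' domains, probes read at step `k`
= the single-cube domains of scale `k + 1` (`scale_dom` by `mem_domAt`); directions, weights and the Re∕Im chart maps are the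
remaining DATA (the instancer's; recipe of record per MAP §2 S-PROBE). -/
def cubeProbes (dirA dirB : ℕ → R.carriers.Dom → V) (wt : ℕ → R.carriers.Dom → ℝ) (chartRe chartIm : ℕ → R.carriers.Dom → V → Bg) :
    Probes R.carriers Bg V R.carriers.Dom where
  idx := cubeIdx R
  dom _ p := p
  scale_dom _ _ hp := scale_of_mem_cubeIdx hp
  dirA := dirA
  dirB := dirB
  wt := wt
  chartRe := chartRe
  chartIm := chartIm

variable {R}
variable {dirA dirB : ℕ → R.carriers.Dom → V} {wt : ℕ → R.carriers.Dom → ℝ} {chartRe chartIm : ℕ → R.carriers.Dom → V → Bg}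

/-- [folklore] The probe index of `cubeProbes` at step `k` is the single-cube catalogue. -/
@[simp] theorem cubeProbes_idx (k : ℕ) : (cubeProbes R dirA dirB wt chartRe chartIm).idx k = cubeIdx R k := rfl

/-- [folklore] The probe domain of `cubeProbes` is the index itself. -/
@[simp] theorem cubeProbes_dom (k : ℕ) (p : R.carriers.Dom) : (cubeProbes R dirA dirB wt chartRe chartIm).dom k p = p := rfl

/-- [folklore] The probe domains of `cubeProbes` are single cubes. -/
theorem cubeProbes_card {k : ℕ} {p : R.carriers.Dom} (hp : p ∈ (cubeProbes R dirA dirB wt chartRe chartIm).idx k) :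
    p.2.1.card = 1 :=
  card_of_mem_cubeIdx hp

variable (dirA dirB wt chartRe chartIm) in
/-- [folklore] Node U2's binder `hne` for the probes of record: every step reads at least one probe. -/
theorem cubeProbes_idx_nonempty (k : ℕ) : ((cubeProbes R dirA dirB wt chartRe chartIm).idx k).Nonempty := cubeIdx_nonempty R k

/-- [folklore] RUN A's PROBES = RUN B's SEEN THROUGH THE TRANSPORT (`Probes.transportTo`): for `cubeProbes` this is the same skeleton
with the charts post-composed with `carriers.transport` — definitionally. -/
theorem transportTo_cubeProbes {dirA dirB : ℕ → R.carriers.Dom → V} {wt : ℕ → R.carriers.Dom → ℝ}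
    (chartRe chartIm : ℕ → R.carriers.Dom → V → R.carriers.BgB) :
    (cubeProbes R dirA dirB wt chartRe chartIm).transportTo =
      cubeProbes R dirA dirB wt (fun k p A => R.carriers.transport (chartRe k p A)) (fun k p A => R.carriers.transport (chartIm k p A)) :=
  rfl

/-! ## §3 The locality sum, exactly -/

/-- [folklore] On single cubes the decay weight of the locality sum is `1`. -/
theorem exp_weight_eq_one {κ : ℝ} {k : ℕ} {p : R.carriers.Dom} (hp : p ∈ cubeIdx R k) :
    Real.exp (-(κ * R.carriers.d p)) = 1 := by
  rw [d_eq_zero_of_mem_cubeIdx hp, mul_zero, neg_zero, Real.exp_zero]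

variable (dirA dirB wt chartRe chartIm) in
/-- [folklore] **THE LOCALITY SUM OF THE PROBES OF RECORD, EXACTLY**: `LocalitySum κ K ↔ ∀ k, Σ_{p ∈ cubeIdx k} |wt|·‖dirA‖·‖dirB‖ ≤ K`
(no dependence on `κ`: single cubes have `d = 0`). -/
theorem localitySum_cubeProbes_iff (κ K : ℝ) :
    (cubeProbes R dirA dirB wt chartRe chartIm).LocalitySum κ K ↔
      ∀ k, ∑ p ∈ cubeIdx R k, |wt k p| * ‖dirA k p‖ * ‖dirB k p‖ ≤ K := by
  unfold Probes.LocalitySum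
  refine forall_congr' fun k => ?_
  rw [cubeProbes_idx]
  have h : ∑ p ∈ cubeIdx R k, |wt k p| * ‖dirA k p‖ * ‖dirB k p‖ * Real.exp (-(κ * R.carriers.d p))
      = ∑ p ∈ cubeIdx R k, |wt k p| * ‖dirA k p‖ * ‖dirB k p‖ :=
    sum_congr rfl fun p hp => by rw [exp_weight_eq_one hp, mul_one]
  exact Iff.of_eq (congrArg (· ≤ K) h)

open scoped Classical in
variable (dirA dirB chartRe chartIm) in
/-- [folklore] THE SUPPORTED FORM: if at every step the weights vanish off a set `s k` of probes whose weighted direction sizes sum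
to at most `K` (e.g. `s k` = the origin cube — the translation-invariant reading of (1.22)'s `Σ_x`), the locality sum holds with
`K`, for every `κ`. -/
theorem localitySum_cubeProbes_of_support (s : ℕ → Finset R.carriers.Dom) (hsupp : ∀ k p, p ∉ s k → wt k p = 0) {K : ℝ}
    (hK : ∀ k, ∑ p ∈ (cubeIdx R k).filter (fun p => p ∈ s k), |wt k p| * ‖dirA k p‖ * ‖dirB k p‖ ≤ K) (κ : ℝ) :
    (cubeProbes R dirA dirB wt chartRe chartIm).LocalitySum κ K := by
  rw [localitySum_cubeProbes_iff]
  intro k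
  rw [← sum_filter_add_sum_filter_not (cubeIdx R k) (fun p => p ∈ s k)]
  have h0 : ∑ p ∈ (cubeIdx R k).filter (fun p => p ∉ s k), |wt k p| * ‖dirA k p‖ * ‖dirB k p‖ = 0 :=
    sum_eq_zero fun p hp => by rw [hsupp k p (mem_filter.1 hp).2, abs_zero, zero_mul, zero_mul]
  rw [h0, add_zero]
  exact hK k

/-- [folklore] The locality-sum terms are nonnegative, so `K ≥ 0` is forced whenever the locality sum holds. -/
theorem localitySum_nonneg {κ K : ℝ} (h : (cubeProbes R dirA dirB wt chartRe chartIm).LocalitySum κ K) : 0 ≤ K := by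
  have h0 := (localitySum_cubeProbes_iff dirA dirB wt chartRe chartIm κ K).1 h 0
  exact le_trans (sum_nonneg fun p _ => by positivity) h0

end Skeleton

/-! ## §4 The analyticity face (NE4 L3 `hAan` shape), DISPLAYED -/

/-- [folklore] THE ANALYTICITY FACE: the complexified slice `A ↦ E g (chartRe A) X_p + i·E g (chartIm A) X_p` of a functional `E` is
holomorphic on the chart set `S k p` for every probe read at step `k` — a DISPLAYED hypothesis of the instance of record (it needs the
non-vanishing of the density on the chart polydisc, a small-field INPUT; never asserted here). -/
def ChartAnalytic {C : Carriers} {Bg : Type} {V : Type*} [NormedAddCommGroup V] [NormedSpace ℂ V] {ι : Type*} (Pr : Probes C Bg V ι)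
    (E : Functional C Bg) (g : ℕ → ℝ) (S : ℕ → ι → Set V) : Prop :=
  ∀ k p, p ∈ Pr.idx k → DifferentiableOn ℂ (Pr.cplx (E g) k p) (S k p)

/-- [folklore] On balls `S k p = ball 0 α`, analytic-on-a-neighbourhood slices (`Probes.Analytic α`, the class node U2 quantifies over)
give the displayed face. -/
theorem chartAnalytic_of_mem_analytic {C : Carriers} {Bg : Type} {V : Type*} [NormedAddCommGroup V] [NormedSpace ℂ V] {ι : Type*}
    (Pr : Probes C Bg V ι) (E : Functional C Bg) (g : ℕ → ℝ) {α : ℝ} (h : E g ∈ Pr.Analytic α) :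
    ChartAnalytic Pr E g (fun _ _ => Metric.ball 0 α) :=
  fun k p hp => (h k p hp).analyticOn.differentiableOn

/-! ## §5 (v1.1) The normalisation face `hnorm` by construction: rescaled and normalised weights -/

section Normalise

variable {C : Carriers} {Bg : Type} {V : Type*} [NormedAddCommGroup V] [NormedSpace ℂ V] {ι : Type*}

/-- [folklore] RESCALING THE WEIGHTS step by step: `wt k p ↦ c k · wt k p`, everything else unchanged. -/
def rescale (Pr : Probes C Bg V ι) (c : ℕ → ℝ) : Probes C Bg V ι where
  idx := Pr.idx
  dom := Pr.dom
  scale_dom := Pr.scale_dom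
  dirA := Pr.dirA
  dirB := Pr.dirB
  wt := fun k p => c k * Pr.wt k p
  chartRe := Pr.chartRe
  chartIm := Pr.chartIm

/-- [folklore] The rescaled weights. -/
@[simp] theorem rescale_wt (Pr : Probes C Bg V ι) (c : ℕ → ℝ) (k : ℕ) (p : ι) : (rescale Pr c).wt k p = c k * Pr.wt k p := rfl

/-- [folklore] Rescaling does not touch the probe index. -/
@[simp] theorem rescale_idx (Pr : Probes C Bg V ι) (c : ℕ → ℝ) : (rescale Pr c).idx = Pr.idx := rfl

/-- [folklore] Rescaling does not touch the rebuilt chart functions (they do not involve the weights). -/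
@[simp] theorem cplx_rescale (Pr : Probes C Bg V ι) (c : ℕ → ℝ) (F : T4BetaReadOut.Slice C Bg) (k : ℕ) (p : ι) :
    (rescale Pr c).cplx F k p = Pr.cplx F k p := rfl

/-- [folklore] … hence not the analytic class node U2 quantifies over. -/
@[simp] theorem analytic_rescale (Pr : Probes C Bg V ι) (c : ℕ → ℝ) (α : ℝ) : (rescale Pr c).Analytic α = Pr.Analytic α := rfl

/-- [folklore] **THE RECIPE IS LINEAR IN THE WEIGHTS**: `(rescale Pr c).recipe k F = c k · Pr.recipe k F`. -/
theorem recipe_rescale (Pr : Probes C Bg V ι) (c : ℕ → ℝ) (k : ℕ) (F : T4BetaReadOut.Slice C Bg) :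
    (rescale Pr c).recipe k F = c k * Pr.recipe k F := by
  simp only [Probes.recipe, rescale_idx, rescale_wt, cplx_rescale, mul_sum]
  refine sum_congr rfl fun p _ => ?_
  simp only [rescale, mul_assoc]

/-- [folklore] Rescaling commutes with the transport (run A's probes = run B's through `carriers.transport`). -/
theorem transportTo_rescale (PB : Probes C C.BgB V ι) (c : ℕ → ℝ) : (rescale PB c).transportTo = rescale PB.transportTo c := rfl

/-- [folklore] Rescaling by factors of size `≤ c₀` turns a locality sum `K` into `c₀·K`. -/
theorem localitySum_rescale (Pr : Probes C Bg V ι) {c : ℕ → ℝ} {c₀ κ K : ℝ} (hc : ∀ k, |c k| ≤ c₀) (hK : Pr.LocalitySum κ K) :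
    (rescale Pr c).LocalitySum κ (c₀ * K) := by
  intro k
  have hK0 : 0 ≤ K := le_trans (sum_nonneg fun p _ => by positivity) (hK k)
  have hc0 : 0 ≤ c₀ := (abs_nonneg _).trans (hc k)
  calc ∑ p ∈ (rescale Pr c).idx k, |(rescale Pr c).wt k p| * ‖(rescale Pr c).dirA k p‖ * ‖(rescale Pr c).dirB k p‖ *
          Real.exp (-(κ * C.d ((rescale Pr c).dom k p)))
      = |c k| * ∑ p ∈ Pr.idx k, |Pr.wt k p| * ‖Pr.dirA k p‖ * ‖Pr.dirB k p‖ * Real.exp (-(κ * C.d (Pr.dom k p))) := by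
        rw [mul_sum]
        refine sum_congr rfl fun p _ => ?_
        simp only [rescale, abs_mul]
        ring
    _ ≤ c₀ * K := mul_le_mul (hc k) (hK k) (sum_nonneg fun p _ => by positivity) hc0

/-- [folklore] **THE WEIGHTS OF RECORD: NORMALISED ON THE MARGINAL DIRECTION** `A` (a run-A slice): run B's probes rescaled step by step by
the inverse of the transported recipe's value on `A`. -/
def normalise (PB : Probes C C.BgB V ι) (A : T4BetaReadOut.Slice C C.BgA) : Probes C C.BgB V ι :=
  rescale PB fun k => (PB.transportTo.recipe k A)⁻¹

/-- [folklore] **NODE U2's BINDER `hnorm` BY CONSTRUCTION**: if the un-normalised transported recipe READS the marginal direction at step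
`k` (value `≠ 0` — the displayed non-degeneracy, an O1 input), the normalised probes read exactly `1` on it. -/
theorem recipe_transportTo_normalise (PB : Probes C C.BgB V ι) (A : T4BetaReadOut.Slice C C.BgA) {k : ℕ}
    (hA : PB.transportTo.recipe k A ≠ 0) : (normalise PB A).transportTo.recipe k A = 1 := by
  rw [normalise, transportTo_rescale, recipe_rescale, inv_mul_cancel₀ hA]

/-- [folklore] The `hnorm` binder in its quantified form: non-degeneracy at every step gives `∀ k, … = 1`. -/
theorem hnorm_normalise (PB : Probes C C.BgB V ι) (A : T4BetaReadOut.Slice C C.BgA) (hA : ∀ k, PB.transportTo.recipe k A ≠ 0) :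
    ∀ k, (normalise PB A).transportTo.recipe k A = 1 :=
  fun k => recipe_transportTo_normalise PB A (hA k)

/-- [folklore] Normalising keeps the analytic classes of both runs' probes. -/
theorem analytic_normalise (PB : Probes C C.BgB V ι) (A : T4BetaReadOut.Slice C C.BgA) (α : ℝ) :
    (normalise PB A).Analytic α = PB.Analytic α ∧ (normalise PB A).transportTo.Analytic α = PB.transportTo.Analytic α :=
  ⟨rfl, rfl⟩

/-- [folklore] Normalising keeps every step reading at least one probe. -/
theorem idx_normalise (PB : Probes C C.BgB V ι) (A : T4BetaReadOut.Slice C C.BgA) : (normalise PB A).idx = PB.idx := rfl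

end Normalise

section NormaliseCube

variable {Bg : Type} {V : Type*} [NormedAddCommGroup V] [NormedSpace ℂ V]
variable {dirA dirB : ℕ → R.carriers.Dom → V} {wt : ℕ → R.carriers.Dom → ℝ}

/-- [folklore] Normalising the probes of record is again a `cubeProbes` (same single-cube index, directions and charts; rescaled weights). -/
theorem normalise_cubeProbes (chartRe chartIm : ℕ → R.carriers.Dom → V → R.carriers.BgB) (A : T4BetaReadOut.Slice R.carriers R.carriers.BgA) :
    normalise (cubeProbes R dirA dirB wt chartRe chartIm) A =
      cubeProbes R dirA dirB
        (fun k p => ((cubeProbes R dirA dirB wt chartRe chartIm).transportTo.recipe k A)⁻¹ * wt k p) chartRe chartIm :=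
  rfl

/-- [folklore] **`hnorm` FOR THE PROBES OF RECORD**: with the normalised weights of record, node U2's binder holds at every step where the
marginal direction is read. -/
theorem hnorm_cubeProbes (chartRe chartIm : ℕ → R.carriers.Dom → V → R.carriers.BgB) (A : T4BetaReadOut.Slice R.carriers R.carriers.BgA)
    (hA : ∀ k, (cubeProbes R dirA dirB wt chartRe chartIm).transportTo.recipe k A ≠ 0) (k : ℕ) :
    (normalise (cubeProbes R dirA dirB wt chartRe chartIm) A).transportTo.recipe k A = 1 :=
  hnorm_normalise _ A hA k

end NormaliseCube

/-! ## §6 (v1.2) The probes of record on the TAGGED complex-chart background sort (`cubeProbesC`) -/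

section Chart

variable {V : Type} [NormedAddCommGroup V] [NormedSpace ℂ V]
open Literature.MathematicalPhysics.QuantumFieldTheory.Balaban1983to89.T4BetaReadOutLipschitz (tagged tagSlice tagged_cplx tagged_recipe)
open Literature.MathematicalPhysics.QuantumFieldTheory.Balaban1983to89.B12Decay510 (mixedDeriv)

/-- [folklore] **SINGLE-CUBE PROBES OF RECORD ON THE TAGGED COMPLEX-CHART SORT** `Bg := V × Bool` (chart point, Re∕Im tag): `cubeProbes`
with the charts of `T4BetaReadOutLipschitz.tagged` — `chartRe A := (A, true)`, `chartIm A := (A, false)` — so that the chart maps LAND IN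
COMPLEX configurations (`V` = a complex chart space, e.g. `SubstrateTransporterSpecies.TowerData P o` of [dict] D-8); directions and
weights stay the instancer's DATA. -/
def cubeProbesC (R : TwoRuns G) (dirA dirB : ℕ → R.carriers.Dom → V) (wt : ℕ → R.carriers.Dom → ℝ) : Probes R.carriers (V × Bool) V R.carriers.Dom :=
  cubeProbes R dirA dirB wt (fun _ _ A => (A, true)) (fun _ _ A => (A, false))

variable {dirA dirB : ℕ → R.carriers.Dom → V} {wt : ℕ → R.carriers.Dom → ℝ}

/-- [folklore] `cubeProbesC` IS the Literature's `tagged` probe structure over the single-cube catalogue (definitionally). -/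
theorem cubeProbesC_eq_tagged :
    cubeProbesC R dirA dirB wt = tagged (cubeIdx R) (fun _ p => p) (fun _ _ hp => scale_of_mem_cubeIdx hp) dirA dirB wt := rfl

/-- [folklore] The probe index of `cubeProbesC` at step `k` is the single-cube catalogue. -/
@[simp] theorem cubeProbesC_idx (k : ℕ) : (cubeProbesC R dirA dirB wt).idx k = cubeIdx R k := rfl

variable (dirA dirB wt) in
/-- [folklore] Node U2's binder `hne` for `cubeProbesC`. -/
theorem cubeProbesC_idx_nonempty (k : ℕ) : ((cubeProbesC R dirA dirB wt).idx k).Nonempty := cubeIdx_nonempty R k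

/-- [folklore] **FAITHFULNESS**: on the tagged slice of a complex term family `E : Dom → V → ℂ` the rebuilt chart function of the probe at
the single cube `p` IS `E p`. -/
theorem cplx_cubeProbesC_tagSlice (E : R.carriers.Dom → V → ℂ) (k : ℕ) (p : R.carriers.Dom) :
    (cubeProbesC R dirA dirB wt).cplx (tagSlice E) k p = E p := by
  rw [cubeProbesC_eq_tagged, tagged_cplx]

/-- [folklore] The recipe of `cubeProbesC` on a tagged slice: `Σ_{p ∈ cubeIdx R k} wt k p · Re ∂²E(p)(dirA k p, dirB k p)`. -/
theorem recipe_cubeProbesC_tagSlice (E : R.carriers.Dom → V → ℂ) (k : ℕ) :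
    (cubeProbesC R dirA dirB wt).recipe k (tagSlice E) = ∑ p ∈ cubeIdx R k, wt k p * (mixedDeriv (E p) (dirA k p) (dirB k p)).re := by
  rw [cubeProbesC_eq_tagged, tagged_recipe]

/-- [folklore] **THE ANALYTIC CLASS OF `cubeProbesC`, EXACTLY**: the tagged slice of `E` lies in `Probes.Analytic α` iff `E p` is analytic on
the ball `‖A‖ < α` at every single cube `p` of every step — at `V := TowerData P o` and entry-built `E` this is what
`SubstrateTransporterSpeciesAnalytic.exists_ball_analyticOnNhd_covAtT` supplies (radius from openness of the regular set). -/
theorem tagSlice_mem_analytic_cubeProbesC_iff (E : R.carriers.Dom → V → ℂ) (α : ℝ) :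
    tagSlice E ∈ (cubeProbesC R dirA dirB wt).Analytic α ↔ ∀ k p, p ∈ cubeIdx R k → AnalyticOnNhd ℂ (E p) (Metric.ball 0 α) := by
  refine ⟨fun h k p hp => ?_, fun h k p hp => ?_⟩
  · have h1 := h k p hp
    rwa [cplx_cubeProbesC_tagSlice] at h1
  · rw [cubeProbesC_idx] at hp
    rw [cplx_cubeProbesC_tagSlice]
    exact h k p hp

/-- [folklore] **THE DISPLAYED ANALYTICITY FACE OF `cubeProbesC`, EXACTLY** (§4 `ChartAnalytic`): for a functional stored as the tagged slices of
a complex family `Ec g : Dom → V → ℂ`, `ChartAnalytic` is ℂ-differentiability of `Ec g p` on the chart set at every single cube. -/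
theorem chartAnalytic_cubeProbesC_iff (Ec : (ℕ → ℝ) → R.carriers.Dom → V → ℂ) (g : ℕ → ℝ) (S : ℕ → R.carriers.Dom → Set V) :
    ChartAnalytic (cubeProbesC R dirA dirB wt) (fun g => tagSlice (Ec g)) g S ↔
      ∀ k p, p ∈ cubeIdx R k → DifferentiableOn ℂ (Ec g p) (S k p) := by
  refine ⟨fun h k p hp => ?_, fun h k p hp => ?_⟩
  · have h1 := h k p hp
    rwa [cplx_cubeProbesC_tagSlice] at h1
  · rw [cubeProbesC_idx] at hp
    rw [cplx_cubeProbesC_tagSlice]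
    exact h k p hp

/-- [folklore] The locality sum of `cubeProbesC`, exactly (single cubes: decay weight `1`). -/
theorem localitySum_cubeProbesC_iff (κ K : ℝ) :
    (cubeProbesC R dirA dirB wt).LocalitySum κ K ↔ ∀ k, ∑ p ∈ cubeIdx R k, |wt k p| * ‖dirA k p‖ * ‖dirB k p‖ ≤ K :=
  localitySum_cubeProbes_iff dirA dirB wt _ _ κ K

end Chart

end Summit.QuantumFields.BalabanUV.T4Continuum.SubstrateProbesOfRecord

end
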